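import Summits.QuantumFields.BalabanUV.T4Continuum.Support.AveragingDeficitPlaqLin

/-!
# AveragingDeficitPlaqLinBound (T⁴ programme, node NE3, row NE3-R2) — (DL) ASSEMBLED: in the region of the axial gauge
# (`‖V(b) − 1‖ ≤ β` within `ℓ¹`-distance `reach d L` of the corner, `(2d+2)Lβ ≤ 1/32`) the derivative `Ω_P` of Bałaban's
# coarse plaquette variable along `V e^{sψ}` is the stencil average of the dressed curl up to
# `plaqLinConst(d,L) · β · ‖ψ‖_{ℓ¹(box)}`

Continuation of `AveragingDeficitPlaqLin` (split for the 400-line rule); honest framing, citation header and placement as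
there and in `AveragingDeficitDerivCore` (unit `b2b-balaban-t4-ne3r2-p1`, row NE3-R2; β = `DeficitDerivWall` NOT proved
here; [folklore] matrix bookkeeping on the tree's (42)/(44)/(48); `[cite:]` tags are CONTEXT; NE3 COND-free; finite-T⁴
rung (B)+1, not Clay).  WHAT IS PROVED: `side_region_bounds` (per side: `‖δV̄(c)‖ ≤ sideNormConst·S`,
`‖δV̄(c) − abLin(c)‖ ≤ sideLinConst·β·S`, `‖V̄(c) − 1‖ ≤ sideDevConst·β`, `S = ‖ψ‖_{ℓ¹(box (reach d L) z)}`) and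
**`norm_plaqOmega_sub_omegaLin_le`**: `‖Ω_P − Ω⁰_P‖ ≤ plaqLinConst d L · β · S`.  Record: HOME `t4/T4-EST-NE3-R2.md`.
-/

set_option autoImplicit false

open scoped BigOperators Matrix Matrix.Norms.L2Operator Topology
open NormedSpace Finset Filter

namespace Summit.QuantumFields.BalabanUV.T4Continuum.AveragingDeficitPlaqLinBound

open Literature.MathematicalPhysics.QuantumFieldTheory.Balaban1983to89
open B7Prop1Explicit B7Prop2Explicit MatrixLog UnitaryModel
open T4AveragingDeficitWall hiding Site Plane Plaq Bond
open T4AveragingDeficitWallBoundary (stencilIdx stencilOff card_stencilIdx)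
open T4AveragingDeficitNonAbelian (Ad_mul Ad_sub)
open AveragingDeficitTransport AveragingDeficitLocality AveragingDeficitNearIdentity AveragingDeficitCounting
open AveragingDeficitSideDeriv AveragingDeficitPlaqDeriv AveragingDeficitDerivCore AveragingDeficitPlaqLin

noncomputable section

variable {d : ℕ} {n : Type*} [Fintype n] [DecidableEq n]

local notation "𝕄" => Matrix n n ℂ
local notation "Site" => B7Prop1Explicit.Site

/-! ## §1 Per-side bounds in the region; §2 the assembled bound -/

/-- `e^t − 1 ≤ 2t` on `[0,1]`. [folklore] -/
private theorem exp_sub_one_le_two_mul' {t : ℝ} (h0 : 0 ≤ t) (h1 : t ≤ 1) : Real.exp t - 1 ≤ 2 * t := by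
  have h := Real.abs_exp_sub_one_sub_id_le (by rw [abs_of_nonneg h0]; exact h1)
  have h' := (abs_le.mp h).2
  nlinarith

/-- The per-side norm constant `32(2d+2)L + L`. [folklore] -/
def sideNormConst (d L : ℕ) : ℝ := 32 * ((2 * d + 2) * L) + L

/-- The per-side linearisation constant. [folklore] -/
def sideLinConst (d L : ℕ) : ℝ :=
  1250 * ((2 * d + 2) * L) * ((2 * d + 2) * L + L) + (2 * ((2 * d + 2) * L) ^ 2 + 2 * (L : ℝ) ^ 2)

/-- The per-side base deviation constant `4(2d+2)L + L`. [folklore] -/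
def sideDevConst (d L : ℕ) : ℝ := 4 * ((2 * d + 2) * L) + L

/-- **ONE SIDE IN THE REGION**: with `S = ‖ψ‖_{ℓ¹(box R₁ z)}`, `W₀ = (2d+2)Lβ ≤ 1/32` and `l1(q − z) ≤ L`:
`‖δV̄(c)‖ ≤ sideNormConst·S`, `‖δV̄(c) − abLin(c)‖ ≤ sideLinConst·β·S`, `‖V̄(c) − 1‖ ≤ sideDevConst·β`. [cite: Balaban1985Averaging, (42) p.23, p.28] -/
theorem side_region_bounds [Nonempty n] (L : ℕ) (hL : 1 ≤ L) {V : Site d → Fin d → 𝕄ˣ} (hV : IsUnitaryCfg V)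
    (ψ : Site d → Fin d → 𝕄) {z q : Site d} {β : ℝ} (hR : RegionBound V z (reach d L) β)
    (hβw : (2 * d + 2) * L * β ≤ 1 / 32) (hq : l1 (q - z) ≤ L) (κ : Fin d) :
    ‖sideDeriv L V ψ q κ‖ ≤ sideNormConst d L * dirL1 ψ (box (reach d L) z) ∧
    ‖sideDeriv L V ψ q κ - abLin L ψ q κ‖ ≤ sideLinConst d L * β * dirL1 ψ (box (reach d L) z) ∧
    ‖((bavg L V q κ : 𝕄ˣ) : 𝕄) - 1‖ ≤ sideDevConst d L * β := by
  have hβ : 0 ≤ β := (norm_nonneg _).trans (hR z κ (by simp [l1]))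
  set S := dirL1 ψ (box (reach d L) z) with hSdef
  have hS : 0 ≤ S := dirL1_nonneg ψ _
  have hW : ∀ r : Fin d → Fin L, ‖((Wcx L V q κ (boxVec L r) : 𝕄ˣ) : 𝕄) - 1‖ ≤ (2 * d + 2) * L * β :=
    fun r => norm_Wcx_sub_one_le_region L hV hR hq κ r
  have hA := loopAvg_le_region L hL hV ψ hq κ (V := V)
  have hs := norm_dhol_seg_le_region L hV ψ hq κ (V := V)
  obtain ⟨h1, h2⟩ := norm_sideDeriv_sub_lin_le L hL hV ψ q κ hβw hW
  have h3 := norm_sideDerivLin_sub_abLin_le L hL hV ψ hR hq κ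
  have hA0 := loopAvg_nonneg L V ψ q κ
  refine ⟨?_, ?_, ?_⟩
  · calc ‖sideDeriv L V ψ q κ‖ ≤ 32 * loopAvg L V ψ q κ + ‖dhol V ψ q (seg κ L)‖ := h2
      _ ≤ 32 * ((2 * d + 2) * L * S) + L * S := add_le_add (mul_le_mul_of_nonneg_left hA (by norm_num)) hs
      _ = sideNormConst d L * S := by unfold sideNormConst; ring
  · calc ‖sideDeriv L V ψ q κ - abLin L ψ q κ‖
        ≤ ‖sideDeriv L V ψ q κ - sideDerivLin L V ψ q κ‖ + ‖sideDerivLin L V ψ q κ - abLin L ψ q κ‖ :=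
          norm_sub_le_norm_sub_add_norm_sub _ _ _
      _ ≤ 1250 * ((2 * d + 2) * L * β) * (loopAvg L V ψ q κ + ‖dhol V ψ q (seg κ L)‖)
          + (2 * ((2 * d + 2) * L) ^ 2 + 2 * (L : ℝ) ^ 2) * β * S := add_le_add h1 h3
      _ ≤ 1250 * ((2 * d + 2) * L * β) * ((2 * d + 2) * L * S + L * S)
          + (2 * ((2 * d + 2) * L) ^ 2 + 2 * (L : ℝ) ^ 2) * β * S :=
          add_le_add (mul_le_mul_of_nonneg_left (add_le_add hA hs) (by positivity)) le_rfl
      _ = sideLinConst d L * β * S := by unfold sideLinConst; ring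
  · -- `‖e^X H − 1‖ ≤ ‖e^X − 1‖ + ‖H − 1‖ ≤ 4W₀ + Lβ`
    have hW4 : ∀ r : Fin d → Fin L, ‖((Wcx L V q κ (boxVec L r) : 𝕄ˣ) : 𝕄) - 1‖ ≤ 1 / 4 := fun r =>
      (hW r).trans (hβw.trans (by norm_num))
    have hXn : ‖Xavg L V q κ‖ ≤ 2 * ((2 * d + 2) * L * β) := norm_Xavg_le L hL V q κ (hβw.trans (by norm_num)) hW
    have hX1 : ‖Xavg L V q κ‖ ≤ 1 := by linarith
    have hUe := expUnit_Xavg_mem_unitary L hV q κ hW4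
    have hE1 : ‖((expUnit (Xavg L V q κ) : 𝕄ˣ) : 𝕄) - 1‖ ≤ 4 * ((2 * d + 2) * L * β) := by
      rw [val_expUnit]
      letI : NormedAlgebra ℚ 𝕄 := NormedAlgebra.restrictScalars ℚ ℝ 𝕄
      calc ‖exp (Xavg L V q κ) - 1‖ ≤ Real.exp ‖Xavg L V q κ‖ - 1 :=
            Literature.Analysis.Calculus.norm_exp_sub_one_le _
        _ ≤ 2 * ‖Xavg L V q κ‖ := exp_sub_one_le_two_mul' (norm_nonneg _) hX1
        _ ≤ 4 * ((2 * d + 2) * L * β) := by linarith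
    have hEn : ‖((expUnit (Xavg L V q κ) : 𝕄ˣ) : 𝕄)‖ ≤ 1 :=
      (CStarRing.norm_of_mem_unitary (mem_unitaryUnits.mp hUe)).le
    have hH : ‖((hol V q (seg κ L) : 𝕄ˣ) : 𝕄) - 1‖ ≤ L * β := by
      have h3 := (reach_ge d L).2.2
      have hlen : (seg κ (L : ℤ)).length = L := by rw [length_seg, Int.natAbs_natCast]
      refine (norm_hol_sub_one_le_of_bonds hV q _ fun b hb => hR b.1 b.2 ?_).trans (by rw [hlen])
      have hb1 := l1_le_of_mem_bondsOf q _ b hb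
      have hb2 := l1_add_le (b.1 - q) (q - z)
      rw [show b.1 - q + (q - z) = b.1 - z by abel] at hb2
      omega
    unfold bavg
    rw [Units.val_mul]
    calc _ ≤ ‖((expUnit (Xavg L V q κ) : 𝕄ˣ) : 𝕄) - 1‖ + ‖((hol V q (seg κ L) : 𝕄ˣ) : 𝕄) - 1‖ :=
          B8Ineq170.norm_mul_sub_one_le_of_norm_le_one hEn
      _ ≤ 4 * ((2 * d + 2) * L * β) + L * β := add_le_add hE1 hH
      _ = sideDevConst d L * β := by unfold sideDevConst; ring

/-- The (DL) constant of one coarse plaquette. [folklore] -/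
def plaqLinConst (d L : ℕ) : ℝ :=
  16 * sideDevConst d L * sideNormConst d L + 4 * sideLinConst d L + 32 * (L : ℝ) ^ 2

/-- Real bookkeeping for the plaquette assembly. [folklore] -/
private theorem plaq_aux {β S cN cL cD L2 e1 e2 e3 e4 b1 b3 b4 D : ℝ}
    (he2 : 0 ≤ e2) (he3 : 0 ≤ e3) (he4 : 0 ≤ e4)
    (hn2 : e2 ≤ cN * S) (hn3 : e3 ≤ cN * S) (hn4 : e4 ≤ cN * S)
    (hb1 : b1 ≤ cD * β) (hb3 : b3 ≤ 3 * (cD * β)) (hb4 : b4 ≤ 4 * (cD * β))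
    (hlin : e1 ≤ 4 * (cL * β * S)) (hD : D ≤ 32 * L2 * β * S) (hb1n : 0 ≤ b1) :
    2 * b1 * e2 + 2 * b3 * e3 + 2 * b4 * e4 + e1 + D ≤ (16 * cD * cN + 4 * cL + 32 * L2) * β * S := by
  have hcDβ : 0 ≤ cD * β := hb1n.trans hb1
  have hcNS : 0 ≤ cN * S := he2.trans hn2
  have h2 : 2 * b1 * e2 ≤ 2 * (cD * β) * (cN * S) := mul_le_mul (by linarith) hn2 he2 (by linarith)
  have h3 : 2 * b3 * e3 ≤ 2 * (3 * (cD * β)) * (cN * S) := mul_le_mul (by linarith) hn3 he3 (by linarith)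
  have h4 : 2 * b4 * e4 ≤ 2 * (4 * (cD * β)) * (cN * S) := mul_le_mul (by linarith) hn4 he4 (by linarith)
  have e : (16 * cD * cN + 4 * cL + 32 * L2) * β * S = 2 * (cD * β) * (cN * S) + 2 * (3 * (cD * β)) * (cN * S)
      + 2 * (4 * (cD * β)) * (cN * S) + 4 * (cL * β * S) + 32 * L2 * β * S := by ring
  rw [e]; linarith

/-- **(DL) — THE DERIVATIVE-LEVEL LINEARISATION OF THE AVERAGE**: in the region (`‖V(b) − 1‖ ≤ β` within `ℓ¹`-distance
`reach d L` of the corner, `(2d+2)Lβ ≤ 1/32`), for unitary `V` and any direction `ψ`,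
`‖Ω_P − L^{−d}Σ_k (d_Vψ)(p_k)‖ ≤ plaqLinConst d L · β · ‖ψ‖_{ℓ¹(box (reach d L) z)}`. [cite: Balaban1985Averaging, (42) p.23, (48) p.25, p.28] -/
theorem norm_plaqOmega_sub_omegaLin_le [Nonempty n] (L : ℕ) (hL : 1 ≤ L) {V : Site d → Fin d → 𝕄ˣ} (hV : IsUnitaryCfg V)
    (ψ : Site d → Fin d → 𝕄) {z : Site d} {β : ℝ} (hR : RegionBound V z (reach d L) β)
    (hβw : (2 * d + 2) * L * β ≤ 1 / 32) (μ ν : Fin d) :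
    ‖plaqOmega L V ψ z μ ν - omegaLin L V ψ z μ ν‖ ≤ plaqLinConst d L * β * dirL1 ψ (box (reach d L) z) := by
  letI : CStarAlgebra 𝕄 := {}
  have hβ : 0 ≤ β := (norm_nonneg _).trans (hR z μ (by simp [l1]))
  set S := dirL1 ψ (box (reach d L) z) with hSdef
  have hS : 0 ≤ S := dirL1_nonneg ψ _
  have hLn : l1 (((L : ℤ) • e μ : Site d)) = L := by rw [l1_zsmul_e, Int.natAbs_natCast]
  have hLn' : l1 (((L : ℤ) • e ν : Site d)) = L := by rw [l1_zsmul_e, Int.natAbs_natCast]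
  have hq1 : l1 (z - z) ≤ L := by simp [l1]
  have hq2 : l1 (z + (L : ℤ) • e μ - z) ≤ L := by rw [add_sub_cancel_left, hLn]
  have hq3 : l1 (z + (L : ℤ) • e ν - z) ≤ L := by rw [add_sub_cancel_left, hLn']
  obtain ⟨n1, l1', b1⟩ := side_region_bounds L hL hV ψ hR hβw hq1 μ
  obtain ⟨n2, l2', b2⟩ := side_region_bounds L hL hV ψ hR hβw hq2 ν
  obtain ⟨n3, l3', b3⟩ := side_region_bounds L hL hV ψ hR hβw hq3 μ
  obtain ⟨n4, l4', b4⟩ := side_region_bounds L hL hV ψ hR hβw hq1 ν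
  -- unitarity of the sides (all loop variables within `1/4`)
  have hW4 : ∀ (q : Site d), l1 (q - z) ≤ L → ∀ (κ : Fin d) (r : Fin d → Fin L),
      ‖((Wcx L V q κ (boxVec L r) : 𝕄ˣ) : 𝕄) - 1‖ ≤ 1 / 4 := fun q hq κ r =>
    (norm_Wcx_sub_one_le_region L hV hR hq κ r).trans (hβw.trans (by norm_num))
  have hu : ∀ (q : Site d), l1 (q - z) ≤ L → ∀ κ : Fin d, bavg L V q κ ∈ unitaryUnits 𝕄 := fun q hq κ =>
    bavg_mem_unitaryUnits hV L q κ (hW4 q hq κ)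
  set B₁ := bavg L V z μ with hB₁
  set B₂ := bavg L V (z + (L : ℤ) • e μ) ν with hB₂
  set B₃ := bavg L V (z + (L : ℤ) • e ν) μ with hB₃
  set B₄ := bavg L V z ν with hB₄
  have hu1 := hu z hq1 μ; have hu2 := hu _ hq2 ν; have hu3 := hu _ hq3 μ; have hu4 := hu z hq1 ν
  rw [← hB₁] at hu1; rw [← hB₂] at hu2; rw [← hB₃] at hu3; rw [← hB₄] at hu4
  set δ₁ := sideDeriv L V ψ z μ
  set δ₂ := sideDeriv L V ψ (z + (L : ℤ) • e μ) ν
  set δ₃ := sideDeriv L V ψ (z + (L : ℤ) • e ν) μ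
  set δ₄ := sideDeriv L V ψ z ν
  -- deviations of the dressing prefixes
  have hn1 : ∀ u : 𝕄ˣ, u ∈ unitaryUnits 𝕄 → ‖(u : 𝕄)‖ ≤ 1 := fun u hu =>
    (CStarRing.norm_of_mem_unitary (mem_unitaryUnits.mp hu)).le
  have hP3 : ‖((B₁ * B₂ * B₃⁻¹ : 𝕄ˣ) : 𝕄) - 1‖ ≤ 3 * (sideDevConst d L * β) := by
    rw [Units.val_mul, Units.val_mul]
    have hi3 : ‖((B₃⁻¹ : 𝕄ˣ) : 𝕄) - 1‖ ≤ sideDevConst d L * β :=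
      (norm_inv_sub_one_le (mem_U1_of_unitary hu3)).trans b3
    calc _ ≤ ‖(B₁ : 𝕄) * (B₂ : 𝕄) - 1‖ + ‖((B₃⁻¹ : 𝕄ˣ) : 𝕄) - 1‖ :=
          B8Ineq170.norm_mul_sub_one_le_of_norm_le_one ((norm_mul_le _ _).trans
            (mul_le_one₀ (hn1 _ hu1) (norm_nonneg _) (hn1 _ hu2)))
      _ ≤ (‖(B₁ : 𝕄) - 1‖ + ‖(B₂ : 𝕄) - 1‖) + ‖((B₃⁻¹ : 𝕄ˣ) : 𝕄) - 1‖ :=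
          add_le_add (B8Ineq170.norm_mul_sub_one_le_of_norm_le_one (hn1 _ hu1)) le_rfl
      _ ≤ (sideDevConst d L * β + sideDevConst d L * β) + sideDevConst d L * β := add_le_add (add_le_add b1 b2) hi3
      _ = 3 * (sideDevConst d L * β) := by ring
  have hP4 : ‖((B₁ * B₂ * B₃⁻¹ * B₄⁻¹ : 𝕄ˣ) : 𝕄) - 1‖ ≤ 4 * (sideDevConst d L * β) := by
    have hu123 : B₁ * B₂ * B₃⁻¹ ∈ unitaryUnits 𝕄 := mul_mem (mul_mem hu1 hu2) (inv_mem hu3)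
    have hi4 : ‖((B₄⁻¹ : 𝕄ˣ) : 𝕄) - 1‖ ≤ sideDevConst d L * β :=
      (norm_inv_sub_one_le (mem_U1_of_unitary hu4)).trans b4
    rw [Units.val_mul]
    calc _ ≤ ‖((B₁ * B₂ * B₃⁻¹ : 𝕄ˣ) : 𝕄) - 1‖ + ‖((B₄⁻¹ : 𝕄ˣ) : 𝕄) - 1‖ :=
          B8Ineq170.norm_mul_sub_one_le_of_norm_le_one (hn1 _ hu123)
      _ ≤ 3 * (sideDevConst d L * β) + sideDevConst d L * β := add_le_add hP3 hi4
      _ = 4 * (sideDevConst d L * β) := by ring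
  -- the dressing errors
  have hd2 : ‖Ad B₁ δ₂ - δ₂‖ ≤ 2 * ‖(B₁ : 𝕄) - 1‖ * ‖δ₂‖ := norm_Ad_sub_le hu1 δ₂
  have hd3 : ‖Ad (B₁ * B₂ * B₃⁻¹) δ₃ - δ₃‖ ≤ 2 * ‖((B₁ * B₂ * B₃⁻¹ : 𝕄ˣ) : 𝕄) - 1‖ * ‖δ₃‖ :=
    norm_Ad_sub_le (mul_mem (mul_mem hu1 hu2) (inv_mem hu3)) δ₃
  have hd4 : ‖Ad (B₁ * B₂ * B₃⁻¹ * B₄⁻¹) δ₄ - δ₄‖ ≤ 2 * ‖((B₁ * B₂ * B₃⁻¹ * B₄⁻¹ : 𝕄ˣ) : 𝕄) - 1‖ * ‖δ₄‖ :=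
    norm_Ad_sub_le (mul_mem (mul_mem (mul_mem hu1 hu2) (inv_mem hu3)) (inv_mem hu4)) δ₄
  -- the abelian part
  have hab : ‖(δ₁ + δ₂ - δ₃ - δ₄) - omegaAb L ψ z μ ν‖ ≤ 4 * (sideLinConst d L * β * S) := by
    have e1 : (δ₁ + δ₂ - δ₃ - δ₄) - omegaAb L ψ z μ ν
        = (δ₁ - abLin L ψ z μ) + (δ₂ - abLin L ψ (z + (L : ℤ) • e μ) ν)
          - (δ₃ - abLin L ψ (z + (L : ℤ) • e ν) μ) - (δ₄ - abLin L ψ z ν) := by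
      unfold omegaAb; abel
    rw [e1]
    calc _ ≤ ‖δ₁ - abLin L ψ z μ‖ + ‖δ₂ - abLin L ψ (z + (L : ℤ) • e μ) ν‖
          + ‖δ₃ - abLin L ψ (z + (L : ℤ) • e ν) μ‖ + ‖δ₄ - abLin L ψ z ν‖ :=
          (norm_sub_le _ _).trans (add_le_add ((norm_sub_le _ _).trans (add_le_add (norm_add_le _ _) le_rfl)) le_rfl)
      _ ≤ _ := by linarith [l1', l2', l3', l4']
  have hD := norm_omegaAb_sub_omegaLin_le L hL hV ψ hR μ ν
  -- assemble
  have e2 : plaqOmega L V ψ z μ ν - omegaLin L V ψ z μ ν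
      = (Ad B₁ δ₂ - δ₂) - (Ad (B₁ * B₂ * B₃⁻¹) δ₃ - δ₃) - (Ad (B₁ * B₂ * B₃⁻¹ * B₄⁻¹) δ₄ - δ₄)
        + ((δ₁ + δ₂ - δ₃ - δ₄) - omegaAb L ψ z μ ν) + (omegaAb L ψ z μ ν - omegaLin L V ψ z μ ν) := by
    unfold plaqOmega plaqDeriv; abel
  rw [e2]
  have htri : ‖(Ad B₁ δ₂ - δ₂) - (Ad (B₁ * B₂ * B₃⁻¹) δ₃ - δ₃) - (Ad (B₁ * B₂ * B₃⁻¹ * B₄⁻¹) δ₄ - δ₄)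
        + ((δ₁ + δ₂ - δ₃ - δ₄) - omegaAb L ψ z μ ν) + (omegaAb L ψ z μ ν - omegaLin L V ψ z μ ν)‖
      ≤ ‖Ad B₁ δ₂ - δ₂‖ + ‖Ad (B₁ * B₂ * B₃⁻¹) δ₃ - δ₃‖ + ‖Ad (B₁ * B₂ * B₃⁻¹ * B₄⁻¹) δ₄ - δ₄‖
        + ‖(δ₁ + δ₂ - δ₃ - δ₄) - omegaAb L ψ z μ ν‖ + ‖omegaAb L ψ z μ ν - omegaLin L V ψ z μ ν‖ :=
    (norm_add_le _ _).trans (add_le_add ((norm_add_le _ _).trans (add_le_add ((norm_sub_le _ _).trans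
      (add_le_add (norm_sub_le _ _) le_rfl)) le_rfl)) le_rfl)
  refine htri.trans ?_
  have key := plaq_aux (cN := sideNormConst d L) (cL := sideLinConst d L) (cD := sideDevConst d L) (L2 := (L : ℝ) ^ 2)
    (norm_nonneg _) (norm_nonneg _) (norm_nonneg _) n2 n3 n4 b1 hP3 hP4 hab hD (norm_nonneg _)
  have e3 : (16 * sideDevConst d L * sideNormConst d L + 4 * sideLinConst d L + 32 * (L : ℝ) ^ 2) * β * S
      = plaqLinConst d L * β * S := by unfold plaqLinConst; ring
  refine le_trans ?_ (key.trans e3.le)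
  linarith [hd2, hd3, hd4]

end

end Summit.QuantumFields.BalabanUV.T4Continuum.AveragingDeficitPlaqLinBound
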